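import Summits.KontsevichZagierPeriods.KontsevichZagierPeriods.Theorems.SoloInformedPresRat
import Summits.KontsevichZagierPeriods.KontsevichZagierPeriods.Theorems.SoloInformedPresRatOne
import HarnessLib

/-!
# SoloInformed — the ladder at the bottom: `PresRat 1`, `PresAll 0`, `CubeDim 0`, `KZPUpTo 1`

Solo programme `solo-KontsevichZagierPeriods-informed`, session s109.  The rung
`soloInformed_presentable_of_isRational_one` (file `SoloInformedPresRatOne`) read on the
dimensionwise ladder of `SoloInformedPresRat`: `SoloInformedPresRat 1` and `SoloInformedPresRat 0`,
`SoloInformedPresAll 0`, `SoloInformedCubeDim 0`, and the truncated transfer in dimension one —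
Ayoub's conjecture up to torsion ALONE implies the period conjecture for rational representations
of dimension `≤ 1` (`soloInformed_kzpUpTo_one_of_ayoubKZeffQ`), the presentability input of the
transfer being a theorem in these dimensions.

References: J. Ayoub, Periods and the conjectures of Grothendieck and Kontsevich–Zagier (2014),
§2.2, Conj. 7, Prop. 11, Rem. 13; J. Viu-Sos, Int. J. Number Theory 17 (2021), Thm. 2.1, §2.3.
-/

noncomputable section

namespace Summit.KontsevichZagierPeriods.KontsevichZagierPeriods.Theorems

/-- **PRES-RAT(1)** on the ladder. [Viu-Sos 2021, Thm. 2.1, §2.3] -/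
theorem soloInformed_presRat_one : SoloInformedPresRat 1 :=
  soloInformed_presentable_of_isRational_one

/-- **PRES(0)**: every integral representation of dimension zero is presentable (by the ladder,
from PRES-RAT(1)). -/
theorem soloInformed_presAll_zero : SoloInformedPresAll 0 :=
  soloInformed_presAll_of_presRat_succ soloInformed_presRat_one

/-- **CUBE(0)**: the dimension-zero slice of the cube crux. -/
theorem soloInformed_cubeDim_zero : SoloInformedCubeDim 0 :=
  soloInformed_cubeDim_of_presAll soloInformed_presAll_zero

/-- **PRES-RAT(0)**. -/
theorem soloInformed_presRat_zero : SoloInformedPresRat 0 :=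
  soloInformed_presRat_of_presAll soloInformed_presAll_zero

/-- **The truncated transfer in dimension one**: Ayoub's conjecture up to torsion alone implies
the period conjecture for rational representations of dimension `≤ 1`.
[Ayoub 2014, §2.2, Conj. 7, Prop. 11, Rem. 13] -/
theorem soloInformed_kzpUpTo_one_of_ayoubKZeffQ (hA : SoloInformedAyoubKZeffQ) :
    SoloInformedKZPUpTo 1 :=
  soloInformed_kzpUpTo_of_presRat soloInformed_presRat_one hA

end Summit.KontsevichZagierPeriods.KontsevichZagierPeriods.Theorems
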